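import Summits.SmoothPoincare4.SmoothPoincare4.Theorems.SymplecticOrigamiOrigamiFoldExistenceStubOuterCleanRecognitionChartShell
import Summits.SmoothPoincare4.SmoothPoincare4.Theorems.SymplecticOrigamiOrigamiFoldExistenceStubCleanOnePleatIroningSigns

/-!
# Stub `stub_outerCleanRecognitionChart` of line `shadow-pleats` for crux `OrigamiFoldExistence` — D:
# the fibre height is MONOTONE along the straightened rays (item stmt-SmoothPoincare4-7844, route SymplecticOrigami; seat c3, S4''-chart worker)

Fourth helper file towards `stub_outerCleanRecognitionChart : OuterCleanRecognitionChart`, over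
files B–C (tube coordinates `tubeW`, `tubeT` of the lifted chart shadow `λ ∘ G` near the
outer fold sphere; the angular straightening `str D`, a norm-preserving diffeomorphism of a good
shell `h : StrShell D` onto itself with inverse `strInv D h.κ`).  In the straightened
coordinates the lifted shadow maps every radial segment `r ↦ r x` (`x ∈ S³`, `|r - 2| < κ`) INTO
ONE TUBE FIBRE:  `λ (G (strInv (r x))) = τ (x, rayT x r • e₀)`  (`liftS4_apply_strInv_smul`),
with the FIBRE HEIGHT PROFILE `rayT D κ x r = tubeT (strInv (r x))`, `rayT x 2 = 0`.  Main results,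
for `G` immersive on the open outer collar `{2 < ‖u‖ < 2 + κ}` (as the chart shadow of a pleated
position is):

* `deriv_rayT_ne_zero` — for `2 < r < 2 + κ` the profile has NON-ZERO DERIVATIVE (if it
  vanished, the curve `r ↦ λ G strInv (r x) = τ(x, rayT x r • e₀)` would have zero velocity, but
  it is an immersed curve: `λ`, `G` and `strInv` are immersions there) — no second-order (fold)
  information is used;
* `strictMonoOn_or_strictAntiOn_rayT` — hence the profile is strictly monotone on `[2, 2 + κ)`
  (Darboux-free: the derivative is continuous and the interval connected), and
  `tubeT_ne_zero_of_outer`: the fibre height does not vanish on the open outer collar;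
* **`exists_outerSign`** (registered helper) — there is a sign `s = ±1` with `0 < s · tubeT u`
  on the whole open outer collar (connectedness), and `s · rayT x` is strictly increasing on
  `[2, 2 + κ)` for every direction `x` (`strictMonoOn_sign_mul_rayT`).

File E turns this into the outer-collar structure of the fold (thin-collar injectivity of `G`,
the one-sided image, local surjectivity onto the side).

Sources: M. W. Hirsch, *Differential Topology* (1976), Ch. 4 §5–§6; the lead's
`OuterClean-analysis-c3.md` §2 (A4)/(v) and §3.
-/

noncomputable section

-- the prescribed namespace `Summit.<P>.<Sub>.…` duplicates `SmoothPoincare4` (P = Sub)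
set_option linter.dupNamespace false

open scoped Manifold ContDiff Topology RealInnerProductSpace
open Set Function Filter Metric
open Literature.Topology.FourManifolds Literature.Topology.FourManifolds.SphereHypersurfaceSides

namespace Summit.SmoothPoincare4.SmoothPoincare4.Theorems.OrigamiFoldExistence.ShadowPleats

section Ray

variable {G : EuclideanSpace ℝ (Fin 4) → EuclideanSpace ℝ (Fin 4)} (D : TubeData (liftS4 ∘ radialSphere G 2))

/-- The FIBRE HEIGHT PROFILE along the straightened ray in direction `x ∈ S³`:
`rayT D κ x r = tubeT (strInv (r • x))`. -/
def rayT (κ : ℝ) (x : Metric.sphere (0 : EuclideanSpace ℝ (Fin 4)) 1) (r : ℝ) : ℝ :=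
  tubeT D (strInv D κ (r • (x : EuclideanSpace ℝ (Fin 4))))

/-- The norm of a point of the ray. -/
theorem norm_smul_sphere {r : ℝ} (hr : 0 ≤ r) (x : Metric.sphere (0 : EuclideanSpace ℝ (Fin 4)) 1) :
    ‖r • (x : EuclideanSpace ℝ (Fin 4))‖ = r := by
  rw [norm_smul, Real.norm_of_nonneg hr, norm_eq_of_mem_sphere, mul_one]

/-- Points of `S³` are non-zero vectors. -/
theorem coe_sphere_ne_zero (x : Metric.sphere (0 : EuclideanSpace ℝ (Fin 4)) 1) : (x : EuclideanSpace ℝ (Fin 4)) ≠ 0 :=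
  ne_zero_of_mem_unit_sphere x

/-- The direction of a positive multiple of a unit vector. -/
theorem inv_norm_smul_smul {r : ℝ} (hr : 0 < r) (x : Metric.sphere (0 : EuclideanSpace ℝ (Fin 4)) 1) :
    ‖r • (x : EuclideanSpace ℝ (Fin 4))‖⁻¹ • (r • (x : EuclideanSpace ℝ (Fin 4))) = x := by
  rw [norm_smul_sphere hr.le, smul_smul, inv_mul_cancel₀ hr.ne', one_smul]

namespace StrShell

variable {D} (h : StrShell D)

/-- Ray points of radius in `(2 - κ, 2 + κ)` lie in the shell. -/
theorem smul_mem_foldShell (x : Metric.sphere (0 : EuclideanSpace ℝ (Fin 4)) 1) {r : ℝ} (hr1 : 2 - h.κ < r)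
    (hr2 : r < 2 + h.κ) : r • (x : EuclideanSpace ℝ (Fin 4)) ∈ foldShell h.κ := by
  have hr : 0 ≤ r := by linarith [h.le_one]
  exact ⟨by rw [norm_smul_sphere hr]; exact hr1, by rw [norm_smul_sphere hr]; exact hr2⟩

/-- **The core point of a straightened ray point is its direction.** -/
theorem tubeW_strInv_smul (x : Metric.sphere (0 : EuclideanSpace ℝ (Fin 4)) 1) {r : ℝ} (hr1 : 2 - h.κ < r)
    (hr2 : r < 2 + h.κ) : tubeW D (strInv D h.κ (r • (x : EuclideanSpace ℝ (Fin 4)))) = x := by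
  have hr : 0 < r := by linarith [h.le_one]
  apply Subtype.ext
  have := h.tubeV_strInv (h.smul_mem_foldShell x hr1 hr2)
  rw [inv_norm_smul_smul hr] at this
  exact this

/-- The profile vanishes at the fold radius. -/
theorem rayT_two (x : Metric.sphere (0 : EuclideanSpace ℝ (Fin 4)) 1) : rayT D h.κ x 2 = 0 := by
  have h2 : ‖(2 : ℝ) • (x : EuclideanSpace ℝ (Fin 4))‖ = 2 := norm_smul_sphere zero_le_two x
  rw [rayT, h.strInv_of_norm h2, tubeT_of_norm D h2]

/-- **The lifted shadow maps each straightened ray into one tube fibre**: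
`λ (G (strInv (r x))) = τ (x, rayT x r • e₀)`. -/
theorem liftS4_apply_strInv_smul (x : Metric.sphere (0 : EuclideanSpace ℝ (Fin 4)) 1) {r : ℝ} (hr1 : 2 - h.κ < r)
    (hr2 : r < 2 + h.κ) :
    liftS4 (G (strInv D h.κ (r • (x : EuclideanSpace ℝ (Fin 4))))) =
      D.τ (x, rayT D h.κ x r • SphereHypersurfaceSides.e₀) := by
  rw [← τ_tubeW_tubeT D (h.subset_tubeDom (h.strInv_mem (h.smul_mem_foldShell x hr1 hr2))),
    h.tubeW_strInv_smul x hr1 hr2]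
  rfl

/-- The profile is `C^∞` on `(2 - κ, 2 + κ)`. -/
theorem contDiffOn_rayT (hG : ContDiff ℝ ∞ G) (x : Metric.sphere (0 : EuclideanSpace ℝ (Fin 4)) 1) :
    ContDiffOn ℝ ∞ (rayT D h.κ x) (Ioo (2 - h.κ) (2 + h.κ)) := by
  have h1 : ContDiffOn ℝ ∞ (fun r : ℝ => r • (x : EuclideanSpace ℝ (Fin 4))) (Ioo (2 - h.κ) (2 + h.κ)) :=
    (contDiff_id.smul contDiff_const).contDiffOn
  have h2 := (h.contDiffOn_strInv hG).comp h1 fun r hr => h.smul_mem_foldShell x hr.1 hr.2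
  exact (contDiffOn_tubeT D hG).comp h2 fun r hr => h.subset_tubeDom (h.strInv_mem (h.smul_mem_foldShell x hr.1 hr.2))

/-- The profile is continuous on `(2 - κ, 2 + κ)`. -/
theorem continuousOn_rayT (hG : ContDiff ℝ ∞ G) (x : Metric.sphere (0 : EuclideanSpace ℝ (Fin 4)) 1) :
    ContinuousOn (rayT D h.κ x) (Ioo (2 - h.κ) (2 + h.κ)) :=
  (h.contDiffOn_rayT hG x).continuousOn

/-- The profile is differentiable at interior radii. -/
theorem hasDerivAt_rayT (hG : ContDiff ℝ ∞ G) (x : Metric.sphere (0 : EuclideanSpace ℝ (Fin 4)) 1) {r : ℝ}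
    (hr1 : 2 - h.κ < r) (hr2 : r < 2 + h.κ) : HasDerivAt (rayT D h.κ x) (deriv (rayT D h.κ x) r) r :=
  (((h.contDiffOn_rayT hG x).contDiffAt (Ioo_mem_nhds hr1 hr2)).differentiableAt (by simp)).hasDerivAt

/-- The derivative of the profile is continuous on `(2 - κ, 2 + κ)`. -/
theorem continuousOn_deriv_rayT (hG : ContDiff ℝ ∞ G) (x : Metric.sphere (0 : EuclideanSpace ℝ (Fin 4)) 1) :
    ContinuousOn (deriv (rayT D h.κ x)) (Ioo (2 - h.κ) (2 + h.κ)) := by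
  have hc := (h.contDiffOn_rayT hG x).continuousOn_derivWithin (uniqueDiffOn_Ioo _ _) (by simp)
  exact hc.congr fun r hr => (derivWithin_of_isOpen isOpen_Ioo hr).symm

/-- **The profile has non-zero derivative off the fold radius** (outer side), provided `G` is
immersive on the open outer collar: otherwise the immersed curve
`r ↦ λ (G (strInv (r x))) = τ (x, rayT x r • e₀)` would have zero velocity. [folklore] -/
theorem deriv_rayT_ne_zero (hG : ContDiff ℝ ∞ G)
    (himm : ∀ u : EuclideanSpace ℝ (Fin 4), 2 < ‖u‖ → ‖u‖ < 2 + h.κ → Injective (fderiv ℝ G u))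
    (x : Metric.sphere (0 : EuclideanSpace ℝ (Fin 4)) 1) {r : ℝ} (hr2 : 2 < r) (hrκ : r < 2 + h.κ) :
    deriv (rayT D h.κ x) r ≠ 0 := by
  intro hzero
  have hr1 : 2 - h.κ < r := by linarith [h.pos]
  have hn : (∞ : WithTop ℕ∞) ≠ 0 := by simp
  set v : EuclideanSpace ℝ (Fin 4) := r • (x : EuclideanSpace ℝ (Fin 4)) with hv_def
  have hv : v ∈ foldShell h.κ := h.smul_mem_foldShell x hr1 hrκ
  -- the curve `c` and its two factorisations
  set c : ℝ → Metric.sphere (0 : EuclideanSpace ℝ (Fin 5)) 1 :=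
    fun r' => liftS4 (G (strInv D h.κ (r' • (x : EuclideanSpace ℝ (Fin 4))))) with hc_def
  set j : ℝ → (Metric.sphere (0 : EuclideanSpace ℝ (Fin 4)) 1) × EuclideanSpace ℝ (Fin 1) :=
    fun t => (x, t • SphereHypersurfaceSides.e₀) with hj_def
  have hj : ContMDiff 𝓘(ℝ, ℝ) ((𝓡 3).prod 𝓘(ℝ, EuclideanSpace ℝ (Fin 1))) ∞ j :=
    contMDiff_const.prodMk (contDiff_id.smul contDiff_const).contMDiff
  have hτj : ContMDiff 𝓘(ℝ, ℝ) (𝓡 4) ∞ (D.τ ∘ j) := D.isSmoothEmbedding.contMDiff.comp hj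
  -- (1) through the tube: zero velocity
  have hray : HasMFDerivAt 𝓘(ℝ, ℝ) 𝓘(ℝ, ℝ) (rayT D h.κ x) r
      (ContinuousLinearMap.smulRight (1 : ℝ →L[ℝ] ℝ) (0 : ℝ)) := by
    have := h.hasDerivAt_rayT hG x hr1 hrκ
    rw [hzero] at this
    exact this.hasFDerivAt.hasMFDerivAt
  have h1 : HasMFDerivAt 𝓘(ℝ, ℝ) (𝓡 4) ((D.τ ∘ j) ∘ rayT D h.κ x) r
      ((mfderiv 𝓘(ℝ, ℝ) (𝓡 4) (D.τ ∘ j) (rayT D h.κ x r)).comp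
        (ContinuousLinearMap.smulRight (1 : ℝ →L[ℝ] ℝ) (0 : ℝ))) :=
    ((hτj _).mdifferentiableAt hn).hasMFDerivAt.comp r hray
  have hceq : c =ᶠ[𝓝 r] (D.τ ∘ j) ∘ rayT D h.κ x := by
    filter_upwards [Ioo_mem_nhds hr1 hrκ] with r' hr'
    exact h.liftS4_apply_strInv_smul x hr'.1 hr'.2
  have hc1 := h1.congr_of_eventuallyEq hceq
  -- (2) through `F = λ ∘ G ∘ strInv` and the ray: the velocity is the image of `x`
  have hstr : DifferentiableAt ℝ (strInv D h.κ) v :=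
    ((h.contDiffOn_strInv hG).contDiffAt ((isOpen_foldShell _).mem_nhds hv)).differentiableAt hn
  have hGd : DifferentiableAt ℝ G (strInv D h.κ v) := hG.differentiable hn _
  have hGs : DifferentiableAt ℝ (G ∘ strInv D h.κ) v := hGd.comp v hstr
  have hL : HasMFDerivAt (𝓡 4) (𝓡 4) liftS4 (G (strInv D h.κ v))
      (mfderiv (𝓡 4) (𝓡 4) liftS4 (G (strInv D h.κ v))) :=
    ((contMDiff_liftS4 _).mdifferentiableAt hn).hasMFDerivAt
  have hF : HasMFDerivAt 𝓘(ℝ, EuclideanSpace ℝ (Fin 4)) (𝓡 4) (fun w => liftS4 ((G ∘ strInv D h.κ) w)) v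
      ((mfderiv (𝓡 4) (𝓡 4) liftS4 (G (strInv D h.κ v))).comp (fderiv ℝ (G ∘ strInv D h.κ) v)) :=
    hL.comp v hGs.hasFDerivAt.hasMFDerivAt
  have hℓ : HasMFDerivAt 𝓘(ℝ, ℝ) 𝓘(ℝ, EuclideanSpace ℝ (Fin 4)) (fun r' : ℝ => r' • (x : EuclideanSpace ℝ (Fin 4))) r
      (ContinuousLinearMap.smulRight (1 : ℝ →L[ℝ] ℝ) ((1 : ℝ) • (x : EuclideanSpace ℝ (Fin 4)))) :=
    ((hasDerivAt_id r).smul_const (x : EuclideanSpace ℝ (Fin 4))).hasFDerivAt.hasMFDerivAt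
  have hc2' := hF.comp r hℓ
  have hc2 : HasMFDerivAt 𝓘(ℝ, ℝ) (𝓡 4) c r
      (((mfderiv (𝓡 4) (𝓡 4) liftS4 (G (strInv D h.κ v))).comp (fderiv ℝ (G ∘ strInv D h.κ) v)).comp
        (ContinuousLinearMap.smulRight (1 : ℝ →L[ℝ] ℝ) ((1 : ℝ) • (x : EuclideanSpace ℝ (Fin 4))))) :=
    hc2'
  -- compare the two velocities on the vector `1`
  have heq := hc1.mfderiv.symm.trans hc2.mfderiv
  have hone : ((1 : ℝ →L[ℝ] ℝ) : ℝ → ℝ) 1 = 1 := rfl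
  have key : (mfderiv (𝓡 4) (𝓡 4) liftS4 (G (strInv D h.κ v)))
      (fderiv ℝ (G ∘ strInv D h.κ) v (x : EuclideanSpace ℝ (Fin 4))) = 0 := by
    have h' := congrArg (fun L : ℝ →L[ℝ] TangentSpace (𝓡 4) (c r) => L 1) heq
    change (mfderiv 𝓘(ℝ, ℝ) (𝓡 4) (D.τ ∘ j) (rayT D h.κ x r)) (((1 : ℝ →L[ℝ] ℝ) : ℝ → ℝ) 1 • (0 : ℝ)) =
      (mfderiv (𝓡 4) (𝓡 4) liftS4 (G (strInv D h.κ v)))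
        (fderiv ℝ (G ∘ strInv D h.κ) v
          ((((1 : ℝ →L[ℝ] ℝ) : ℝ → ℝ) 1) • ((1 : ℝ) • (x : EuclideanSpace ℝ (Fin 4))))) at h'
    rw [hone] at h'
    simp only [one_smul, smul_zero] at h'
    exact h'.symm.trans (ContinuousLinearMap.map_zero _)
  -- injectivity of the three differentials
  have hnorm : ‖strInv D h.κ v‖ = r := by rw [h.norm_strInv hv, hv_def, norm_smul_sphere (by linarith) x]
  have hinjG : Injective (fderiv ℝ (G ∘ strInv D h.κ) v) := by
    rw [fderiv_comp v hGd hstr]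
    exact (himm _ (by rw [hnorm]; exact hr2) (by rw [hnorm]; exact hrκ)).comp (h.injective_fderiv_strInv hG hv)
  have h0 : fderiv ℝ (G ∘ strInv D h.κ) v (x : EuclideanSpace ℝ (Fin 4)) = 0 :=
    injective_mfderiv_liftS4 _ (key.trans (map_zero _).symm)
  exact coe_sphere_ne_zero x (hinjG (h0.trans (map_zero _).symm))

/-- **The profile is strictly monotone on `[2, 2 + κ)`** (increasing or decreasing), for `G`
immersive on the open outer collar. [folklore] -/
theorem strictMonoOn_or_strictAntiOn_rayT (hG : ContDiff ℝ ∞ G)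
    (himm : ∀ u : EuclideanSpace ℝ (Fin 4), 2 < ‖u‖ → ‖u‖ < 2 + h.κ → Injective (fderiv ℝ G u))
    (x : Metric.sphere (0 : EuclideanSpace ℝ (Fin 4)) 1) :
    StrictMonoOn (rayT D h.κ x) (Ico 2 (2 + h.κ)) ∨ StrictAntiOn (rayT D h.κ x) (Ico 2 (2 + h.κ)) := by
  have hκ := h.pos
  have hcont : ContinuousOn (rayT D h.κ x) (Ico 2 (2 + h.κ)) :=
    (h.continuousOn_rayT hG x).mono fun r hr => ⟨by linarith [hr.1], hr.2⟩
  -- the derivative has constant sign on `(2, 2 + κ)`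
  have hpre : IsPreconnected (deriv (rayT D h.κ x) '' Ioo 2 (2 + h.κ)) :=
    isPreconnected_Ioo.image _ ((h.continuousOn_deriv_rayT hG x).mono fun r hr => ⟨by linarith [hr.1], hr.2⟩)
  have hsub : deriv (rayT D h.κ x) '' Ioo 2 (2 + h.κ) ⊆ Ioi 0 ∪ Iio 0 := by
    rintro _ ⟨r, hr, rfl⟩
    rcases (h.deriv_rayT_ne_zero hG himm x hr.1 hr.2).lt_or_gt with hlt | hgt
    · exact Or.inr hlt
    · exact Or.inl hgt
  rcases hpre.subset_or_subset isOpen_Ioi isOpen_Iio (Set.disjoint_left.2 fun _ h1 h2 => lt_asymm h1 h2) hsub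
    with hpos | hneg
  · left
    refine strictMonoOn_of_deriv_pos (convex_Ico 2 (2 + h.κ)) hcont fun r hr => ?_
    rw [interior_Ico] at hr
    exact hpos ⟨r, hr, rfl⟩
  · right
    refine strictAntiOn_of_deriv_neg (convex_Ico 2 (2 + h.κ)) hcont fun r hr => ?_
    rw [interior_Ico] at hr
    exact hneg ⟨r, hr, rfl⟩

/-- The profile does not vanish on `(2, 2 + κ)`. -/
theorem rayT_ne_zero (hG : ContDiff ℝ ∞ G)
    (himm : ∀ u : EuclideanSpace ℝ (Fin 4), 2 < ‖u‖ → ‖u‖ < 2 + h.κ → Injective (fderiv ℝ G u))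
    (x : Metric.sphere (0 : EuclideanSpace ℝ (Fin 4)) 1) {r : ℝ} (hr2 : 2 < r) (hrκ : r < 2 + h.κ) :
    rayT D h.κ x r ≠ 0 := by
  rw [← h.rayT_two x]
  have h2mem : (2 : ℝ) ∈ Ico 2 (2 + h.κ) := ⟨le_rfl, by linarith [h.pos]⟩
  have hrmem : r ∈ Ico 2 (2 + h.κ) := ⟨hr2.le, hrκ⟩
  rcases h.strictMonoOn_or_strictAntiOn_rayT hG himm x with hm | hm
  · exact (hm h2mem hrmem hr2).ne'
  · exact (hm h2mem hrmem hr2).ne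

/-- A point of the open outer collar, read through the straightening: `u = strInv (‖u‖ • x)`
with `x` the direction of `str u`, and `tubeT u = rayT x ‖u‖`. -/
theorem exists_eq_strInv_smul {u : EuclideanSpace ℝ (Fin 4)} (hu : u ∈ foldShell h.κ) :
    ∃ x : Metric.sphere (0 : EuclideanSpace ℝ (Fin 4)) 1,
      ‖u‖ • (x : EuclideanSpace ℝ (Fin 4)) = str D u ∧ strInv D h.κ (‖u‖ • (x : EuclideanSpace ℝ (Fin 4))) = u ∧
      tubeT D u = rayT D h.κ x ‖u‖ := by
  refine ⟨tubeW D u, rfl, ?_, ?_⟩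
  · exact h.strInv_str hu
  · show tubeT D u = tubeT D (strInv D h.κ (str D u))
    rw [h.strInv_str hu]

/-- **The fibre height does not vanish on the open outer collar.** -/
theorem tubeT_ne_zero_of_outer (hG : ContDiff ℝ ∞ G)
    (himm : ∀ u : EuclideanSpace ℝ (Fin 4), 2 < ‖u‖ → ‖u‖ < 2 + h.κ → Injective (fderiv ℝ G u))
    {u : EuclideanSpace ℝ (Fin 4)} (hu2 : 2 < ‖u‖) (huκ : ‖u‖ < 2 + h.κ) : tubeT D u ≠ 0 := by
  obtain ⟨x, -, -, hT⟩ := h.exists_eq_strInv_smul (u := u) ⟨by linarith [h.pos], huκ⟩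
  rw [hT]
  exact h.rayT_ne_zero hG himm x hu2 huκ

/-- **THE OUTER SIGN**: the fibre height has one sign `s = ±1` on the whole open outer collar
(it is continuous and non-vanishing there, and the collar is connected). [folklore] -/
theorem exists_outerSign (hG : ContDiff ℝ ∞ G)
    (himm : ∀ u : EuclideanSpace ℝ (Fin 4), 2 < ‖u‖ → ‖u‖ < 2 + h.κ → Injective (fderiv ℝ G u)) :
    ∃ s : ℝ, (s = 1 ∨ s = -1) ∧
      ∀ u : EuclideanSpace ℝ (Fin 4), 2 < ‖u‖ → ‖u‖ < 2 + h.κ → 0 < s * tubeT D u := by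
  set Ω : Set (EuclideanSpace ℝ (Fin 4)) := {u | 2 < ‖u‖ ∧ ‖u‖ < 2 + h.κ} with hΩ
  have hΩsub : Ω ⊆ tubeDom D := fun u hu => h.subset_tubeDom ⟨by linarith [h.pos, hu.1], hu.2⟩
  have hcont : ContinuousOn (tubeT D) Ω := (contDiffOn_tubeT D hG).continuousOn.mono hΩsub
  have hpre : IsPreconnected (tubeT D '' Ω) := (isPreconnected_openShell two_pos).image _ hcont
  have hsub : tubeT D '' Ω ⊆ Ioi 0 ∪ Iio 0 := by
    rintro _ ⟨u, hu, rfl⟩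
    rcases (h.tubeT_ne_zero_of_outer hG himm hu.1 hu.2).lt_or_gt with hlt | hgt
    · exact Or.inr hlt
    · exact Or.inl hgt
  rcases hpre.subset_or_subset isOpen_Ioi isOpen_Iio (Set.disjoint_left.2 fun _ h1 h2 => lt_asymm h1 h2) hsub
    with hpos | hneg
  · exact ⟨1, Or.inl rfl, fun u hu2 huκ => by rw [one_mul]; exact hpos ⟨u, ⟨hu2, huκ⟩, rfl⟩⟩
  · exact ⟨-1, Or.inr rfl, fun u hu2 huκ => by
      have : tubeT D u < 0 := hneg ⟨u, ⟨hu2, huκ⟩, rfl⟩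
      nlinarith⟩

/-- **With the outer sign, every profile is strictly INCREASING on `[2, 2 + κ)`.** -/
theorem strictMonoOn_sign_mul_rayT (hG : ContDiff ℝ ∞ G)
    (himm : ∀ u : EuclideanSpace ℝ (Fin 4), 2 < ‖u‖ → ‖u‖ < 2 + h.κ → Injective (fderiv ℝ G u))
    {s : ℝ} (hs : s = 1 ∨ s = -1)
    (hsign : ∀ u : EuclideanSpace ℝ (Fin 4), 2 < ‖u‖ → ‖u‖ < 2 + h.κ → 0 < s * tubeT D u)
    (x : Metric.sphere (0 : EuclideanSpace ℝ (Fin 4)) 1) :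
    StrictMonoOn (fun r => s * rayT D h.κ x r) (Ico 2 (2 + h.κ)) := by
  -- a test radius in the open collar, where `s * rayT > 0 = s * rayT 2`
  set r₁ : ℝ := 2 + h.κ / 2 with hr₁
  have hr₁2 : 2 < r₁ := by rw [hr₁]; linarith [h.pos]
  have hr₁κ : r₁ < 2 + h.κ := by rw [hr₁]; linarith [h.pos]
  have hpos₁ : 0 < s * rayT D h.κ x r₁ := by
    have hu : strInv D h.κ (r₁ • (x : EuclideanSpace ℝ (Fin 4))) ∈ foldShell h.κ :=
      h.strInv_mem (h.smul_mem_foldShell x (by linarith [h.pos]) hr₁κ)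
    have hnorm : ‖strInv D h.κ (r₁ • (x : EuclideanSpace ℝ (Fin 4)))‖ = r₁ := by
      rw [h.norm_strInv (h.smul_mem_foldShell x (by linarith [h.pos]) hr₁κ), norm_smul_sphere (by linarith) x]
    exact hsign _ (by rw [hnorm]; exact hr₁2) (by rw [hnorm]; exact hr₁κ)
  have h2mem : (2 : ℝ) ∈ Ico 2 (2 + h.κ) := ⟨le_rfl, by linarith [h.pos]⟩
  have hr₁mem : r₁ ∈ Ico 2 (2 + h.κ) := ⟨hr₁2.le, hr₁κ⟩
  rcases h.strictMonoOn_or_strictAntiOn_rayT hG himm x with hm | hm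
  · rcases hs with rfl | rfl
    · simpa only [one_mul] using hm
    · exfalso
      have := hm h2mem hr₁mem hr₁2
      rw [h.rayT_two] at this
      nlinarith
  · rcases hs with rfl | rfl
    · exfalso
      have := hm h2mem hr₁mem hr₁2
      rw [h.rayT_two] at this
      nlinarith
    · intro a ha b hb hab
      have := hm ha hb hab
      show -1 * rayT D h.κ x a < -1 * rayT D h.κ x b
      nlinarith

end StrShell

end Ray

end Summit.SmoothPoincare4.SmoothPoincare4.Theorems.OrigamiFoldExistence.ShadowPleats

end
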